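import Literature.NumberTheory.EllipticCurves.Kato2004.ZetaBodyLayerValuesProofs
import Literature.NumberTheory.EllipticCurves.Kato2004.IwasawaCohomologyUniqueProofs
import Literature.NumberTheory.GaloisRepresentations.ContinuousCorestrictionRelConj
import HarnessLib

set_option autoImplicit false

/-!
# AUG engine, step 1 (Kato §13.9 «the images under (13.7.1)», BEFORE characters): the LEVEL VALUES of `Λ`-multiples of a
# lifted Kato family, and the character-free level identity of a collinear pair `F • y₁ = G • y₂` in ONE pin
# (seat `bsd-cm-prr-ty1` g14, cell `bsd-cm`; theorems only: no definition, no named fact, no instance, no `sorry`)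

Part 43 of the seat's kernel cut of stub 3 of the Kato–Perrin-Riou skeletons v4 (cruxes stmt-BirchSwinnertonDyer-19945 /
-19223).  After Parts 38–42 the display PR-INV reads PR-INV ⟸ {lev, `Kato2004.thm12_4`, AUG}, AUG being the augmentation
identity `e·(q₁R₁E₁)·F(0) = (q₂R₂E₂)·G(0)` for a primitive collinear pair `F • y₁ = G • y₂` of the two lifted families
(E28 `katoRigid_of_thm12_4_of_aug`).  Kato proves it (p. 230, L84–85) «by computing the images of these elements … under the
map (13.7.1) by using Thm 6.6 and Thm 9.7»: FIRST the images at every finite level, THEN the value law character by character,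
Rohrlich and Weierstrass.  THIS FILE is the first step, entirely in the tree's currency and character-free:
* §1–§2: `r(conj_γ − 1)` commutes with corestriction (`coresLe_conjMap`: `cor` is `G`-equivariant, NSW Prop. 1.5.4) and
  `res ∘ cor = Σ_δ conj_δ` (`resLe_coresLe_eq_sum_conjMap`, NSW (1.5.6)–(1.5.7));
* §3–§4: for a `ℤ_p`-linear functional `Λ₀` on `H¹(ℚ(μ_{p^{n+1}}), T_pW)` with `Λ₀ ∘ conj_σ = τ_σ ∘ Λ₀` ((C3a)-shape, `τ` ANY
  endomorphism family) and a lift `y` in a pin `I` (`I.proj n y = Cor ξ`), the `Λ`-action being LEVELWISE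
  (`IwasawaH1Data.proj_smul`: `proj_n (F • y) = r(conj_γ − 1)(proj_n y)` for `r ≡ F mod ω_n`):
  **`Λ₀ (res (proj_n (F • y))) = Σ_x τ_{s x} (r(τ_γ − 1) (Λ₀ ξ))`** (`apply_resLe_proj_smul`);
* §5: for two `ZetaBody` families of one newform lifted into one pin with `Λ₂ = e • Λ₁` on level `p^{n+1}` and a collinearity
  `F • y₁ = G • y₂`: **`Σ_x τ_{s x} (r_F(τ_γ − 1)(e • (1 ⊗ x₁(n+1,𝟙)))) = Σ_x τ_{s x} (r_G(τ_γ − 1)(1 ⊗ x₂(n+1,𝟙)))`** in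
  `ℚ_p ⊗ ℚ(ζ_{p^{n+1}})` (`sum_twist_aeval_eq_of_smul_eq_smul`; apply `Λ₂ ∘ res ∘ proj_n`, read (C4) for both families);
* §6: the twist family `τ` exists (`exists_twistEnd`: `1 ⊗ σ̃` restricted to `ℤ_p`), so §5 is not vacuous.
NEXT (not here): read §5 through `charSum` and the embeddings `ιᵢ` (the twists `χ̄(a_m)`), insert the value law (C5) for every
Dirichlet character mod `p^{n+1}`, Rohrlich, the coherence of `(a_m)`, and Weierstrass (HOME `STUB3-CUT.md` §6 addendum 6).
HONEST LABEL: theorems about the tree's readings only; nothing about Kato's classes, Kato's Main Conjecture or Perrin-Riou is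
asserted; AUG stays displayed; no stub is closed; nothing is asserted on 19945 / 19223; BSD is not proved for any curve.
References: [Kato2004Asterisque] §12.2 (p. 220), §13.8 (p. 228), §13.9 (p. 230); [NeukirchSchmidtWingberg2008] I §5 Prop. 1.5.4,
(1.5.6)–(1.5.7); [Washington1997] §7.1, §13.2; [Lang1990] Ch. 5 §1 Thm. 1.1.
-/

noncomputable section

open scoped BigOperators NumberField TensorProduct
open Polynomial Field IsDedekindDomain CongruenceSubgroup
open Literature.NumberTheory.GaloisRepresentations
open Literature.NumberTheory.EllipticCurves Literature.NumberTheory.EllipticCurves.ModularForms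
open Literature.NumberTheory.EllipticCurves.Kato2004 Literature.NumberTheory.EllipticCurves.Kato2004.EulerSystemValues
open Rat.HeightOneSpectrum

namespace Summit.BirchSwinnertonDyer.Rank1Residual.Additive.PerrinRiouUnit

/-! ## §1 Intertwining `r(a − 1)` along a semiconjugating linear map -/

section Semiconj

variable {R : Type*} [CommRing R] {M M' : Type*} [AddCommGroup M] [Module R M] [AddCommGroup M'] [Module R M']

/-- If `Φ ∘ a = a' ∘ Φ` then `Φ (r(a − 1) m) = r(a' − 1) (Φ m)` for every polynomial `r`. [folklore] -/
theorem map_aeval_sub_one_of_semiconj (Φ : M →ₗ[R] M') (a : Module.End R M) (a' : Module.End R M')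
    (h : ∀ m, Φ (a m) = a' (Φ m)) (r : R[X]) (m : M) :
    Φ (aeval (a - 1) r m) = aeval (a' - 1) r (Φ m) := by
  induction r using Polynomial.induction_on generalizing m with
  | C c => simp only [aeval_C, Module.algebraMap_end_apply, map_smul]
  | add f g hf hg => simp only [map_add, LinearMap.add_apply, hf, hg]
  | monomial k c hk =>
    rw [pow_succ, ← mul_assoc, map_mul (aeval (a - 1)), map_mul (aeval (a' - 1)), aeval_X, aeval_X,
      Module.End.mul_apply, Module.End.mul_apply, hk, LinearMap.sub_apply, LinearMap.sub_apply, Module.End.one_apply,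
      Module.End.one_apply, map_sub, h]

end Semiconj

/-! ## §2 Corestriction commutes with `r(conj_γ − 1)` -/

section Cohomology

universe u v

variable {R : Type u} [CommRing R] [TopologicalSpace R] {G : Type v} [Group G] [TopologicalSpace G]
  [IsTopologicalGroup G] (X : TopRep.{v} R G)

/-- **`cor ∘ r(conj_g − 1) = r(conj_g − 1) ∘ cor`** on `H¹` for `N ≤ U` both normal, `N` open of finite index in `U`
(`coresLe_conjMap`: the corestriction is `G`-equivariant; §1). [cite: NeukirchSchmidtWingberg2008, I §5 Prop. 1.5.4] -/
theorem coresLe_aeval_conjMap_sub_one {N U : Subgroup G} [N.Normal] [U.Normal] (h : N ≤ U) (hN : IsOpen (N : Set G))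
    [Fintype (U ⧸ N.subgroupOf U)] (g : G) (r : R[X]) (ξ : continuousCohomology 1 (subgroupRep X N)) :
    coresLe X h hN (aeval ((conjMap X N g 1).hom.toLinearMap - 1) r ξ) =
      aeval ((conjMap X U g 1).hom.toLinearMap - 1) r (coresLe X h hN ξ) :=
  map_aeval_sub_one_of_semiconj (coresLe X h hN) _ _ (fun m => coresLe_conjMap X h hN g m) r ξ

/-- **`res ∘ cor ∘ r(conj_g − 1) = Σ_x conj_{s x} ∘ r(conj_g − 1)`**: the double-coset formula after §2
`coresLe_aeval_conjMap_sub_one`. [cite: NeukirchSchmidtWingberg2008, I §5 Prop. 1.5.4 and (1.5.6)–(1.5.7)] -/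
theorem resLe_aeval_coresLe_eq_sum {N U : Subgroup G} [N.Normal] [U.Normal] (h : N ≤ U) (hN : IsOpen (N : Set G))
    [Fintype (U ⧸ N.subgroupOf U)] {s : U ⧸ N.subgroupOf U → U} (hs : ∀ x, (s x : U ⧸ N.subgroupOf U) = x)
    (g : G) (r : R[X]) (ξ : continuousCohomology 1 (subgroupRep X N)) :
    resLe X h 1 (aeval ((conjMap X U g 1).hom.toLinearMap - 1) r (coresLe X h hN ξ)) =
      ∑ x, conjMap X N (s x : G) 1 (aeval ((conjMap X N g 1).hom.toLinearMap - 1) r ξ) := by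
  rw [← coresLe_aeval_conjMap_sub_one X h hN g r ξ, resLe_coresLe_eq_sum_conjMap X h hN hs]

end Cohomology

/-! ## §3 Values: a `Gal`-equivariant functional reads `res (r(conj_γ − 1) (cor ξ))` as `Σ_δ τ_δ (r(τ_γ − 1) (Λ₀ ξ))` -/

section Values

variable {W : WeierstrassCurve ℚ} [W.IsElliptic] {p : ℕ} [Fact p.Prime] [ContinuousSMul ℤ_[p] (W.tateModule p)]
  {V : Type*} [AddCommGroup V] [Module ℤ_[p] V]

/-- **The value of `res (r(conj_g − 1)(cor ξ))`.**  For `N ≤ U` (normal, `N` open of finite index in `U`), a `ℤ_p`-linear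
`Λ₀ : H¹(N, T_pW) → V` and an endomorphism family `τ` with `Λ₀ ∘ conj_σ = τ_σ ∘ Λ₀` ((C3a)-shape):
`Λ₀ (res (r(conj_g − 1) (cor ξ))) = Σ_x τ_{s x} (r(τ_g − 1) (Λ₀ ξ))`. [cite: Kato2004Asterisque, §13.8 (p. 228)]
[cite: NeukirchSchmidtWingberg2008, I §5 (1.5.6)–(1.5.7)] -/
theorem apply_resLe_aeval_coresLe {N U : Subgroup (absoluteGaloisGroup ℚ)} [N.Normal] [U.Normal] (h : N ≤ U)
    (hN : IsOpen (N : Set (absoluteGaloisGroup ℚ))) [Fintype (U ⧸ N.subgroupOf U)] {s : U ⧸ N.subgroupOf U → U}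
    (hs : ∀ x, (s x : U ⧸ N.subgroupOf U) = x)
    (Λ₀ : H1 (tateRep W p) N →ₗ[ℤ_[p]] V) (τ : absoluteGaloisGroup ℚ → Module.End ℤ_[p] V)
    (hΛ : ∀ (σ : absoluteGaloisGroup ℚ) (y : H1 (tateRep W p) N), Λ₀ (conjMap (tateRep W p).toTopRep N σ 1 y) = τ σ (Λ₀ y))
    (g : absoluteGaloisGroup ℚ) (r : ℤ_[p][X]) (ξ : H1 (tateRep W p) N) :
    Λ₀ (resLe (tateRep W p).toTopRep h 1
        (aeval ((conjMap (tateRep W p).toTopRep U g 1).hom.toLinearMap - 1) r (coresLe (tateRep W p).toTopRep h hN ξ))) =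
      ∑ x, τ (s x : absoluteGaloisGroup ℚ) (aeval (τ g - 1) r (Λ₀ ξ)) := by
  rw [resLe_aeval_coresLe_eq_sum (tateRep W p).toTopRep h hN hs g r ξ, map_sum]
  refine Finset.sum_congr rfl fun x _ => ?_
  rw [hΛ, map_aeval_sub_one_of_semiconj Λ₀ _ _ (hΛ g) r ξ]

end Values

/-! ## §4 The pin: `Λ₀ (res (proj_n (F • y))) = Σ_δ τ_δ (r(τ_γ − 1) (Λ₀ z_{n+1,∅}))` -/

section Pin

variable {W : WeierstrassCurve ℚ} [W.IsElliptic] {p : ℕ} [Fact p.Prime] [ContinuousSMul ℤ_[p] (W.tateModule p)]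
  {K : ZpExtension ℚ p} {γ : absoluteGaloisGroup ℚ} {V : Type*} [AddCommGroup V] [Module ℤ_[p] V]

/-- **Layer values of a `Λ`-multiple of a lift.**  In a pin `I` (`γ` a topological generator) let `y` lift the level
classes `ξ` (`I.proj n y = Cor ξ` for the layer `U = K.layerSubgroup n ≥ N`), and let `r ≡ F (mod ω_n = (1+X)^{p^n} − 1)`.
Then `Λ₀ (res (proj_n (F • y))) = Σ_x τ_{s x} (r(τ_γ − 1) (Λ₀ ξ))` (`IwasawaH1Data.proj_smul`: the `Λ`-action is
levelwise `r(conj_γ − 1)`; §3). [cite: Kato2004Asterisque, §12.2 (p. 220), §13.8 (p. 228)] [cite: Washington1997, §13.2] -/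
theorem apply_resLe_proj_smul (hγ : K.IsTopGenerator γ) (I : IwasawaH1Data W p K γ) (n : ℕ)
    {N : Subgroup (absoluteGaloisGroup ℚ)} [N.Normal] (h : N ≤ K.layerSubgroup n)
    (hN : IsOpen (N : Set (absoluteGaloisGroup ℚ))) [Fintype (K.layerSubgroup n ⧸ N.subgroupOf (K.layerSubgroup n))]
    {s : K.layerSubgroup n ⧸ N.subgroupOf (K.layerSubgroup n) → K.layerSubgroup n}
    (hs : ∀ x, (s x : K.layerSubgroup n ⧸ N.subgroupOf (K.layerSubgroup n)) = x)
    (Λ₀ : H1 (tateRep W p) N →ₗ[ℤ_[p]] V) (τ : absoluteGaloisGroup ℚ → Module.End ℤ_[p] V)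
    (hΛ : ∀ (σ : absoluteGaloisGroup ℚ) (y : H1 (tateRep W p) N), Λ₀ (conjMap (tateRep W p).toTopRep N σ 1 y) = τ σ (Λ₀ y))
    {y : I.H} {ξ : H1 (tateRep W p) N} (hy : I.proj n y = coresLe (tateRep W p).toTopRep h hN ξ)
    {F : IwasawaAlgebra p} {r : ℤ_[p][X]}
    (hfr : F - (r : PowerSeries ℤ_[p]) ∈
      Ideal.span {(((Polynomial.X + 1 : ℤ_[p][X]) ^ p ^ n - 1 : ℤ_[p][X]) : PowerSeries ℤ_[p])}) :
    Λ₀ (resLe (tateRep W p).toTopRep h 1 (I.proj n (F • y))) =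
      ∑ x, τ (s x : absoluteGaloisGroup ℚ) (aeval (τ γ - 1) r (Λ₀ ξ)) := by
  rw [I.proj_smul hγ n hfr, hy]
  exact apply_resLe_aeval_coresLe h hN hs Λ₀ τ hΛ γ r ξ

end Pin


/-! ## §5 Two `ZetaBody` families in one pin: the character-free level identity of a collinear pair -/

section Collinear

variable {W : WeierstrassCurve ℚ} [W.IsElliptic] {p : ℕ} [Fact p.Prime] [ContinuousSMul ℤ_[p] (W.tateModule p)]
  [Module.Free ℤ_[p] (W.tateModule p)] [Module.Finite ℤ_[p] (W.tateModule p)]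
  {N : ℕ} {f : CuspForm (Gamma0 N) 2} {ι₁ ι₂ : (m : ℕ) → (CyclotomicField m ℚ →+* ℂ)} {κ₁ κ₂ : ℝ}
  {Λ₁ Λ₂ : ∀ (k : ℕ) (r : Finset (HeightOneSpectrum (𝓞 ℚ))),
    H1 (tateRep W p) (cycSubgroup p k r) →ₗ[ℤ_[p]] ℚ_[p] ⊗[ℚ] CyclotomicField (cycLevel p k r) ℚ}
  {c₁ d₁ a₁ : ℤ} {A₁ : ℕ} {c₂ d₂ a₂ : ℤ} {A₂ : ℕ}
  {z₁ : ∀ (k : ℕ) (r : (cyclotomicLevelsRat p (badPlaces c₁ d₁ A₁ N)).Ideals),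
    H1 (tateRep W p) ((cyclotomicLevelsRat p (badPlaces c₁ d₁ A₁ N)).level k r.1)}
  {x₁ : ∀ (k : ℕ) (r : (cyclotomicLevelsRat p (badPlaces c₁ d₁ A₁ N)).Ideals), CyclotomicField (cycLevel p k r.1) ℚ}
  {z₂ : ∀ (k : ℕ) (r : (cyclotomicLevelsRat p (badPlaces c₂ d₂ A₂ N)).Ideals),
    H1 (tateRep W p) ((cyclotomicLevelsRat p (badPlaces c₂ d₂ A₂ N)).level k r.1)}
  {x₂ : ∀ (k : ℕ) (r : (cyclotomicLevelsRat p (badPlaces c₂ d₂ A₂ N)).Ideals), CyclotomicField (cycLevel p k r.1) ℚ}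
  {K : ZpExtension ℚ p} {γ : absoluteGaloisGroup ℚ}

/-- **The level identity of a collinear pair (Kato §13.9, before characters).**  Two `ZetaBody` families `(zᵢ, xᵢ)` of
the same newform with value maps `Λ₂ = e • Λ₁` on level `p^{n+1}`, lifted into ONE pin `I` (`I.proj n yᵢ = Cor zᵢ(n+1, 𝟙)`),
and a collinearity `F • y₁ = G • y₂` in `𝐇¹` with polynomial representatives `r_F ≡ F`, `r_G ≡ G (mod ω_n)`, satisfy, for
every endomorphism family `τ` realising the (C3a)-twists on `ℚ_p ⊗ ℚ(ζ_{p^{n+1}})` and representatives `s` of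
`Gal(ℚ̄/ℚ_n)/Gal(ℚ̄/ℚ(μ_{p^{n+1}}))`:
`Σ_x τ_{s x} (r_F(τ_γ − 1) (e • (1 ⊗ x₁(n+1,𝟙)))) = Σ_x τ_{s x} (r_G(τ_γ − 1) (1 ⊗ x₂(n+1,𝟙)))`.
Proof: apply `Λ₂ (n+1) ∅ ∘ res ∘ proj_n` to the collinearity (§4 for both lifts, with (C3a) of `Λ₂`), and read
`Λ₂ z₂ = 1 ⊗ x₂` (C4), `Λ₂ z₁ = e • Λ₁ z₁ = e • (1 ⊗ x₁)` ((C4) and `Λ₂ = e • Λ₁`).  Nothing about Kato's classes is asserted.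
[cite: Kato2004Asterisque, §13.8 (p. 228) and §13.9 (p. 230)] [cite: NeukirchSchmidtWingberg2008, I §5 Prop. 1.5.4, (1.5.6)–(1.5.7)] -/
theorem sum_twist_aeval_eq_of_smul_eq_smul (hb₁ : ZetaBody W p f ι₁ κ₁ Λ₁ c₁ d₁ a₁ A₁ z₁ x₁)
    (hb₂ : ZetaBody W p f ι₂ κ₂ Λ₂ c₂ d₂ a₂ A₂ z₂ x₂) (hK : K.IsCyclotomic) (hp : p ≠ 2) (hγ : K.IsTopGenerator γ)
    (I : IwasawaH1Data W p K γ) (n : ℕ) {y₁ y₂ : I.H}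
    (hy₁ : I.proj n y₁ = levelToLayer W p hK hp (badPlaces c₁ d₁ A₁ N) n
      (z₁ (n + 1) (cyclotomicLevelsRat p (badPlaces c₁ d₁ A₁ N)).idealOne))
    (hy₂ : I.proj n y₂ = levelToLayer W p hK hp (badPlaces c₂ d₂ A₂ N) n
      (z₂ (n + 1) (cyclotomicLevelsRat p (badPlaces c₂ d₂ A₂ N)).idealOne))
    {e : ℚ_[p]} (hΛ : ∀ y : H1 (tateRep W p) (cycSubgroup p (n + 1) ∅), Λ₂ (n + 1) ∅ y = e • Λ₁ (n + 1) ∅ y)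
    (τ : absoluteGaloisGroup ℚ → Module.End ℤ_[p] (ℚ_[p] ⊗[ℚ] CyclotomicField (cycLevel p (n + 1) ∅) ℚ))
    (hτ : ∀ (σ : absoluteGaloisGroup ℚ) (t : ℚ_[p] ⊗[ℚ] CyclotomicField (cycLevel p (n + 1) ∅) ℚ),
      τ σ t = Algebra.TensorProduct.map (AlgHom.id ℚ ℚ_[p])
        (sigma (cycLevel p (n + 1) ∅) (modNCyclotomicCharacter ℚ (cycLevel p (n + 1) ∅) σ) :
          CyclotomicField (cycLevel p (n + 1) ∅) ℚ →ₐ[ℚ] CyclotomicField (cycLevel p (n + 1) ∅) ℚ) t)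
    {s : K.layerSubgroup n ⧸ (cycSubgroup p (n + 1) ∅).subgroupOf (K.layerSubgroup n) → K.layerSubgroup n}
    (hs : ∀ x, (s x : K.layerSubgroup n ⧸ (cycSubgroup p (n + 1) ∅).subgroupOf (K.layerSubgroup n)) = x)
    {F G : IwasawaAlgebra p} {rF rG : ℤ_[p][X]}
    (hF : F - (rF : PowerSeries ℤ_[p]) ∈
      Ideal.span {(((Polynomial.X + 1 : ℤ_[p][X]) ^ p ^ n - 1 : ℤ_[p][X]) : PowerSeries ℤ_[p])})
    (hG : G - (rG : PowerSeries ℤ_[p]) ∈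
      Ideal.span {(((Polynomial.X + 1 : ℤ_[p][X]) ^ p ^ n - 1 : ℤ_[p][X]) : PowerSeries ℤ_[p])})
    (hFG : F • y₁ = G • y₂) :
    letI : Fintype (K.layerSubgroup n ⧸ (cycSubgroup p (n + 1) ∅).subgroupOf (K.layerSubgroup n)) := Fintype.ofFinite _
    ∑ x, τ (s x : absoluteGaloisGroup ℚ)
        (aeval (τ γ - 1) rF (e • ((1 : ℚ_[p]) ⊗ₜ[ℚ] (x₁ (n + 1) (cyclotomicLevelsRat p (badPlaces c₁ d₁ A₁ N)).idealOne :
          CyclotomicField (cycLevel p (n + 1) ∅) ℚ)))) =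
      ∑ x, τ (s x : absoluteGaloisGroup ℚ)
        (aeval (τ γ - 1) rG ((1 : ℚ_[p]) ⊗ₜ[ℚ] (x₂ (n + 1) (cyclotomicLevelsRat p (badPlaces c₂ d₂ A₂ N)).idealOne :
          CyclotomicField (cycLevel p (n + 1) ∅) ℚ))) := by
  letI : Fintype (K.layerSubgroup n ⧸ (cycSubgroup p (n + 1) ∅).subgroupOf (K.layerSubgroup n)) := Fintype.ofFinite _
  have hle : cycSubgroup p (n + 1) ∅ ≤ K.layerSubgroup n :=
    hK.cyclotomicLevelsRat_level_succ_le_layerSubgroup hp (badPlaces c₁ d₁ A₁ N) n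
  obtain ⟨-, -, -, -, hC4₁, -⟩ := hb₁
  obtain ⟨-, -, hC3a₂, -, hC4₂, -⟩ := hb₂
  -- (C3a) of `Λ₂` through `τ`
  have hΛτ : ∀ (σ : absoluteGaloisGroup ℚ) (y : H1 (tateRep W p) (cycSubgroup p (n + 1) ∅)),
      Λ₂ (n + 1) ∅ (conjMap (tateRep W p).toTopRep (cycSubgroup p (n + 1) ∅) σ 1 y) = τ σ (Λ₂ (n + 1) ∅ y) := by
    intro σ y
    rw [hC3a₂, hτ]
  -- the two lifts in `coresLe` form
  have hy₁' : I.proj n y₁ = coresLe (tateRep W p).toTopRep hle ((cyclotomicLevelsRat p ∅).isOpen_level (n + 1) ∅)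
      (z₁ (n + 1) (cyclotomicLevelsRat p (badPlaces c₁ d₁ A₁ N)).idealOne :
        H1 (tateRep W p) (cycSubgroup p (n + 1) ∅)) := by
    rw [hy₁]; unfold levelToLayer; rfl
  have hy₂' : I.proj n y₂ = coresLe (tateRep W p).toTopRep hle ((cyclotomicLevelsRat p ∅).isOpen_level (n + 1) ∅)
      (z₂ (n + 1) (cyclotomicLevelsRat p (badPlaces c₂ d₂ A₂ N)).idealOne :
        H1 (tateRep W p) (cycSubgroup p (n + 1) ∅)) := by
    rw [hy₂]; unfold levelToLayer; rfl
  -- (C4) at level `(n+1, 𝟙)` for both families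
  have hξ₁ : Λ₁ (n + 1) ∅ (z₁ (n + 1) (cyclotomicLevelsRat p (badPlaces c₁ d₁ A₁ N)).idealOne) =
      (1 : ℚ_[p]) ⊗ₜ[ℚ] (x₁ (n + 1) (cyclotomicLevelsRat p (badPlaces c₁ d₁ A₁ N)).idealOne :
        CyclotomicField (cycLevel p (n + 1) ∅) ℚ) :=
    hC4₁ (n + 1) (cyclotomicLevelsRat p (badPlaces c₁ d₁ A₁ N)).idealOne
  have hξ₂ : Λ₂ (n + 1) ∅ (z₂ (n + 1) (cyclotomicLevelsRat p (badPlaces c₂ d₂ A₂ N)).idealOne) =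
      (1 : ℚ_[p]) ⊗ₜ[ℚ] (x₂ (n + 1) (cyclotomicLevelsRat p (badPlaces c₂ d₂ A₂ N)).idealOne :
        CyclotomicField (cycLevel p (n + 1) ∅) ℚ) :=
    hC4₂ (n + 1) (cyclotomicLevelsRat p (badPlaces c₂ d₂ A₂ N)).idealOne
  -- `Λ₂ ∘ res ∘ proj_n` of the collinearity
  have key := congrArg (fun w => Λ₂ (n + 1) ∅ (resLe (tateRep W p).toTopRep hle 1 (I.proj n w))) hFG
  simp only at key
  rw [apply_resLe_proj_smul hγ I n hle _ hs (Λ₂ (n + 1) ∅) τ hΛτ hy₁' hF,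
    apply_resLe_proj_smul hγ I n hle _ hs (Λ₂ (n + 1) ∅) τ hΛτ hy₂' hG, hΛ, hξ₁, hξ₂] at key
  exact key

end Collinear


/-! ## §6 Non-vacuity: the (C3a)-twists ARE realised by a `ℤ_p`-linear endomorphism family -/

section Twist

variable (p : ℕ) [Fact p.Prime] (m : ℕ) [NeZero m]

/-- **The twist family exists**: `σ ↦ 1 ⊗ σ̃` (`σ̃ = sigma m (χ_cyc σ)`) is a family of `ℤ_p`-linear endomorphisms of
`ℚ_p ⊗ ℚ(ζ_m)` agreeing with the (C3a) maps `Algebra.TensorProduct.map (AlgHom.id ℚ ℚ_[p]) σ̃` (the `ℚ_p`-algebra map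
`Algebra.TensorProduct.map (AlgHom.id ℚ_[p] ℚ_[p]) σ̃`, restricted to `ℤ_p`; equal on pure tensors). [folklore] -/
theorem exists_twistEnd :
    ∃ τ : absoluteGaloisGroup ℚ → Module.End ℤ_[p] (ℚ_[p] ⊗[ℚ] CyclotomicField m ℚ),
      ∀ (σ : absoluteGaloisGroup ℚ) (t : ℚ_[p] ⊗[ℚ] CyclotomicField m ℚ),
        τ σ t = Algebra.TensorProduct.map (AlgHom.id ℚ ℚ_[p])
          (sigma m (modNCyclotomicCharacter ℚ m σ) : CyclotomicField m ℚ →ₐ[ℚ] CyclotomicField m ℚ) t := by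
  refine ⟨fun σ => ((Algebra.TensorProduct.map (AlgHom.id ℚ_[p] ℚ_[p])
      (sigma m (modNCyclotomicCharacter ℚ m σ) : CyclotomicField m ℚ →ₐ[ℚ] CyclotomicField m ℚ)).toLinearMap).restrictScalars ℤ_[p],
    fun σ t => ?_⟩
  rw [LinearMap.restrictScalars_apply, AlgHom.toLinearMap_apply]
  induction t using TensorProduct.induction_on with
  | zero => rw [map_zero, map_zero]
  | tmul s x => rw [Algebra.TensorProduct.map_tmul, Algebra.TensorProduct.map_tmul, AlgHom.id_apply, AlgHom.id_apply]
  | add t₁ t₂ h₁ h₂ => rw [map_add, map_add, h₁, h₂]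

end Twist

end Summit.BirchSwinnertonDyer.Rank1Residual.Additive.PerrinRiouUnit

end
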